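import Mathlib
import HarnessLib
import Summits.CriticalPhenomena.CardyFormulaZ2.Theses.CardySelfDualSegment
import Literature.Probability.Percolation.CornerPercolation
import Literature.Probability.RandomPlanarGeometry.ShearModulusAnalytic
import Summits.CriticalPhenomena.CardyFormulaZ2.Theorems.CardySelfDualSegmentSegmentOpenStubCrossingProbPolynomial
import Summits.CriticalPhenomena.CardyFormulaZ2.Theorems.CardySelfDualSegmentSegmentOpenStubVitaliTransfer
import Summits.CriticalPhenomena.CardyFormulaZ2.Theorems.CardySelfDualSegmentSegmentOpenStubAccumulationInteriorGood

/-!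
# Crux `SegmentOpen` (stmt-CriticalPhenomena-5471), line `Sketch` — the reduction, kernel-checked

`SegmentOpen := UniformMarginality → IsOpen G`, `G = {t ∈ [0,1] | ∃ α, 0 < im α ∧ CardyMod t α}`.
This helper file records IN THE TREE (sorry-free, as an implication) what the lead's line skeleton
`Cruxes/SegmentOpen/Lines/Sketch.lean` proves modulo its three open stubs: the crux follows from

* (S4) `UniformComplexBound` — the crossing polynomials `t ↦ P_t(R, δ)` (S1,
  `stub_crossingProbPolynomial`, landed) are bounded on ONE complex disc around each `t₀ ∈ [0,1]`,
  radius uniform in the conformal rectangle `R`, bound uniform in the mesh `δ`;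
* (S6) `NoIsolatedGoodPoint` — under UniformMarginality no point of `G` is isolated in `G`;
* (S7) the Literature named fact `Literature.Probability.RandomPlanarGeometry.ShearCrossRatioAnalytic`
  (Ahlfors–Bers: the modulus of the sheared quad `φ_α R'` is real-analytic in `α`),

using the LANDED stubs S1 (`stub_crossingProbPolynomial`, p97364), S2' (`stub_vitaliTransferUniform`,
p123660) and S5' (`stub_accumulationInteriorGood`, p125317).  The two hypotheses S4 and S6 are
written out verbatim (tree vocabulary, exactly the registered stub signatures); they are NOT claimed.
Logic: S1 + S4 ⇒ weak uniform analyticity near every `t₀`; S7 + S2' + S5' ⇒ a good accumulation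
point of `G` with weak uniform analyticity is interior; S6 ⇒ every good point is an accumulation
point; hence `G ⊆ interior G`.
-/

noncomputable section

namespace Summit.CriticalPhenomena.CardyFormulaZ2.Theorems

open Literature.Probability Literature.Barriers.CriticalPhenomena
open Literature.Probability.RandomPlanarGeometry (ConformalRectangle ConformalEquiv MarkedDomain
  ShearCrossRatioAnalytic)
open Filter Set Topology

/-- S1 + S4 ⇒ weak uniform analyticity near `t₀`: with the radius `r` of the uniform complex bound,
every `t ↦ P_t(R, δ)` is the restriction of a holomorphic function (the crossing polynomial mapped
to `ℂ`) bounded by `C(R)` on the disc `B(t₀, r)`, for all meshes `δ`. -/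
theorem SegmentOpenSketch.uaNear_of_uniformComplexBound (t₀ : unitInterval)
    (h4 : ∃ r > 0, ∀ R : ConformalRectangle, ∃ C : ℝ, ∀ δ : ℝ, 0 < δ →
      ∀ p : Polynomial ℝ,
        (∀ t : unitInterval, Percolation.cornerCrossingProb t R δ = p.eval (t : ℝ)) →
        ∀ z ∈ Metric.ball ((t₀ : ℝ) : ℂ) r, ‖(p.map (algebraMap ℝ ℂ)).eval z‖ ≤ C) :
    ∃ r > 0, ∀ R : ConformalRectangle, ∃ C : ℝ, ∀ δ : ℝ, 0 < δ →
      ∃ f : ℂ → ℂ, DifferentiableOn ℂ f (Metric.ball ((t₀ : ℝ) : ℂ) r) ∧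
        (∀ z ∈ Metric.ball ((t₀ : ℝ) : ℂ) r, ‖f z‖ ≤ C) ∧
        ∀ t : unitInterval, dist t t₀ < r →
          f ((t : ℝ) : ℂ) = Percolation.cornerCrossingProb t R δ := by
  obtain ⟨r, hr, hR⟩ := h4
  refine ⟨r, hr, fun R => ?_⟩
  obtain ⟨C, hC⟩ := hR R
  refine ⟨C, fun δ hδ => ?_⟩
  obtain ⟨p, hp⟩ := stub_crossingProbPolynomial R δ hδ
  refine ⟨fun z => (p.map (algebraMap ℝ ℂ)).eval z, ?_, ?_, ?_⟩
  · exact (Polynomial.differentiable _).differentiableOn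
  · intro z hz
    exact hC δ hδ p hp z hz
  · intro t _
    rw [hp t]
    change (p.map (algebraMap ℝ ℂ)).eval (algebraMap ℝ ℂ (t : ℝ)) = _
    rw [Polynomial.eval_map, Polynomial.eval₂_at_apply]
    rfl

/-- **Line `Sketch` reduces the crux `SegmentOpen` to S4 + S6 + Ahlfors–Bers.**  If (S4) the
crossing polynomials are uniformly complex-bounded near every `t₀ ∈ [0,1]` (radius uniform in `R`,
bound uniform in `δ`), (S6) under UniformMarginality every good parameter is an accumulation point
of the good set `G`, and (S7) the named fact `ShearCrossRatioAnalytic` holds, then `SegmentOpen`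
holds.  Composition of the landed stubs `stub_crossingProbPolynomial` (S1),
`stub_vitaliTransferUniform` (S2') and `stub_accumulationInteriorGood` (S5'): every good point is
an accumulation point (S6), hence interior (S5' fed by S7, S2' and S1 + S4), so `G` is open.
CONDITIONAL on the named fact S7; S4 and S6 are explicit hypotheses (the line's open stubs,
registered signatures verbatim). -/
theorem segmentOpen_of_uniformComplexBound_of_noIsolatedGoodPoint :
    (∀ t₀ : unitInterval, ∃ r > 0, ∀ R : ConformalRectangle, ∃ C : ℝ, ∀ δ : ℝ, 0 < δ →
      ∀ p : Polynomial ℝ,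
        (∀ t : unitInterval, Percolation.cornerCrossingProb t R δ = p.eval (t : ℝ)) →
        ∀ z ∈ Metric.ball ((t₀ : ℝ) : ℂ) r, ‖(p.map (algebraMap ℝ ℂ)).eval z‖ ≤ C) →
    ((∀ (t₀ : unitInterval) (R : ConformalRectangle) (ε : ℝ), 0 < ε → ∃ η > 0,
        ∀ t : unitInterval, dist t t₀ < η → ∀ δ : ℝ, 0 < δ →
          |Percolation.cornerCrossingProb t R δ - Percolation.cornerCrossingProb t₀ R δ| < ε) →
      ∀ t₀ ∈ {t : unitInterval | ∃ α : ℂ, 0 < α.im ∧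
          ∀ (R R' : ConformalRectangle)
            (φ : ConformalEquiv UpperHalfPlane.upperHalfPlaneSet R.carrier) (x : Fin 4 → ℝ),
            R.carrier = moduliShear α '' R'.carrier → (∀ i, R.pt i = moduliShear α (R'.pt i)) →
            R.IsUniformizing φ x →
            Tendsto (Percolation.cornerCrossingProb t R') (𝓝[>] 0)
              (𝓝 (RandomPlanarGeometry.cardyFunction (RandomPlanarGeometry.crossRatio x)))},
        AccPt t₀ (𝓟 {t : unitInterval | ∃ α : ℂ, 0 < α.im ∧
          ∀ (R R' : ConformalRectangle)
            (φ : ConformalEquiv UpperHalfPlane.upperHalfPlaneSet R.carrier) (x : Fin 4 → ℝ),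
            R.carrier = moduliShear α '' R'.carrier → (∀ i, R.pt i = moduliShear α (R'.pt i)) →
            R.IsUniformizing φ x →
            Tendsto (Percolation.cornerCrossingProb t R') (𝓝[>] 0)
              (𝓝 (RandomPlanarGeometry.cardyFunction (RandomPlanarGeometry.crossRatio x)))})) →
    ShearCrossRatioAnalytic →
    Summit.CriticalPhenomena.CardyFormulaZ2.Theses.CardySelfDualSegment.SegmentOpen := by
  intro h4 h6 h7 hUM
  rw [← subset_interior_iff_isOpen]
  intro t ht
  exact stub_accumulationInteriorGood h7 (fun t₀ R r => stub_vitaliTransferUniform t₀ R r) t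
    (SegmentOpenSketch.uaNear_of_uniformComplexBound t (h4 t)) ht (h6 hUM t ht)

end Summit.CriticalPhenomena.CardyFormulaZ2.Theorems
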